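import Summits.BirchSwinnertonDyer.BirchSwinnertonDyer.Theorems.ResidualThetaTransportAtTwoRlfLayerWitnessClass
import Summits.BirchSwinnertonDyer.BirchSwinnertonDyer.Theorems.ResidualThetaTransportAtTwoRlfTwistLayerRes
import HarnessLib

/-!
# Route `ResidualThetaTransportAtTwo` (RTT P6, item stmt-BirchSwinnertonDyer-23110, road T), ISO θ-plan, LAYER DICTIONARY brick (D1) at
# EVERY layer `m`: a point `b ∈ A` with `g^{2^m} b ≡ b (mod 2^J A)` is the witness point of a continuous `U_m`-cocycle of `E[2^J]|`

Lead seat `bsd-wall-tp2-p2x` g13 (cell `bsd-wall`), line `hplusdual` on 23110 (stub `stub_iso`). THEOREMS ONLY (no definition, no named fact,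
no instance, no `sorry`); closes nothing; 23110 is NOT proved; BSD is NOT proved by any of this.

This is w2 g16's `TwistedLocalKummer.exists_layerCocycle_of_layerFixed` (`…RlfLayerWitnessClass`, the case layer `= J =` torsion exponent)
with the layer index `m` decoupled from the torsion exponent `J` — needed by the θ-plan, whose pairings `B_n` live on ALL layers `n` of
`S[2^J]` (`PlusDual.forall_mem_omegaIdeal_of_compatible`). The proof is theirs verbatim (Kummer cocycle of a `2^J`-th root `Q` of `b` on
`N = Gal(ℚ̄_v/ℚ_{v,∞})`, `g^{2^m}`-invariance of its class from `g^{2^m}Q − Q ≡ w (mod E[2^J])`, extension over `U_m/N ≅ ℤ₂` by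
`exists_resSubgroup_eq_of_conjMap_eq_of_padicInt` for the layer character `κ_m = 2^{-m}κ|_{U_m}` of `TwistedLocalKummer.exists_layerCharacter`).

* `exists_layerCocycle_of_layerFixed_at` — (D1) at layer `m`, torsion `2^J`.

References: B. D. Kim, Compositio Math. 143 (2007), Prop. 3.15 (proof) [BDKim2007]; R. Greenberg, LNM 1716 (1999), §3 p. 86, §4 p. 124
[GreenbergLNM1716]; J.-P. Serre, *Galois Cohomology* I §2.6 (b) [SerreGaloisCohomology1997]; L. Washington, *Cyclotomic Fields* §13.1 [Washington1997].
-/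

-- the Theorems namespace of this sub repeats the summit name by design (D-0017 nested layout)
set_option linter.dupNamespace false

noncomputable section

open scoped Classical NumberField
open CategoryTheory Function Field NumberField IsDedekindDomain

namespace Summit.BirchSwinnertonDyer.BirchSwinnertonDyer.Theorems.SignedEC.LayerWitnessDict

open Literature.NumberTheory.EllipticCurves Literature.NumberTheory.GaloisRepresentations WeierstrassCurve ZpExtension
  Literature.NumberTheory.EllipticCurves.Kobayashi2003 Literature.NumberTheory.EllipticCurves.Sprung2012 SignedKatoOffTwo
  TwistedLocalKummer
open scoped ContRepresentation

universe u

variable (W : WeierstrassCurve ℚ) [W.IsElliptic]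

set_option maxHeartbeats 800000 in
-- as in `TwistedLocalKummer.exists_layerCocycle_of_layerFixed`: many `ContinuousRep`/`TopRep` bridges, one long elaboration
/-- **(D1) Layer-`m` point classes come from `U_m`-cocycles, at every layer `m`** (w2 g16's `exists_layerCocycle_of_layerFixed` is `m = J`; same
proof with the layer character `κ_m`). For `b ∈ A` with `g^{2^m} b − b ∈ 2^J A` there are a continuous `U_m`-cocycle `ψ` of `E[2^J]|` and a root
`Q`, `2^J Q = b`, with `ψ(τ) = τQ − Q` on points for `τ ∈ N`. [cite: BDKim2007, Prop. 3.15 (proof)] [cite: GreenbergLNM1716, §4 p. 124]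
[cite: SerreGaloisCohomology1997, I §2.6 (b)] -/
theorem exists_layerCocycle_of_layerFixed_at (κ : ZpExtension ℚ 2) (J m : ℕ)
    (v : HeightOneSpectrum (𝓞 ℚ)) {g : absoluteGaloisGroup (v.adicCompletion ℚ)}
    (hg : κ.IsTopGenerator (resGalOfEmb (closureEmb (K := ℚ) (v.adicCompletion ℚ)) g))
    {b : localPoints W (v.adicCompletion ℚ)} (hb : b ∈ ⨆ n, signedLocalPoints κ (v.adicCompletion ℚ) W 1 n)
    (hfix : ∃ w ∈ (⨆ n, signedLocalPoints κ (v.adicCompletion ℚ) W 1 n), g ^ (2 ^ m) • b - b = 2 ^ J • w) :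
    ∃ (ψ : contOneCocycles (subgroupRep (LayerPairing.torsionLocalRep W (2 ^ J) v) (LayerPairing.layerGroup κ v m)))
      (Q : localPoints W (v.adicCompletion ℚ)), 2 ^ J • Q = b ∧
      ∀ (τ : absoluteGaloisGroup (v.adicCompletion ℚ)) (hτ : τ ∈ localSubgroup κ.kerSubgroup (v.adicCompletion ℚ)),
        pointsMap W (v.adicCompletion ℚ) ((ψ.1 ⟨τ, TwistLayer.localSubgroup_le_layerGroup κ v m hτ⟩ : W.geomTorsion ((2 ^ J : ℕ) : ℤ)) :
          W.geomPoints) = τ • Q - Q := by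
  haveI : Fact (Nat.Prime 2) := ⟨Nat.prime_two⟩
  let U : Subgroup (absoluteGaloisGroup (v.adicCompletion ℚ)) := LayerPairing.layerGroup κ v m
  let N : Subgroup (absoluteGaloisGroup (v.adicCompletion ℚ)) := localSubgroup κ.kerSubgroup (v.adicCompletion ℚ)
  haveI hNnormal : N.Normal := by
    change (localSubgroup κ.kerSubgroup (v.adicCompletion ℚ)).Normal
    rw [localSubgroup_eq_comap]; infer_instance
  have hNU : N ≤ U := TwistLayer.localSubgroup_le_layerGroup κ v m
  set A : AddSubgroup (localPoints W (v.adicCompletion ℚ)) := ⨆ n, signedLocalPoints κ (v.adicCompletion ℚ) W 1 n with hAdef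
  haveI : CompactSpace (absoluteGaloisGroup (v.adicCompletion ℚ)) := absoluteGaloisGroup_compactSpace (v.adicCompletion ℚ)
  haveI : CompactSpace U := isCompact_iff_compactSpace.mp
    ((Subgroup.isClosed_of_isOpen U (LayerPairing.isOpen_layerGroup κ v m)).isCompact)
  let n : ℤ := ((2 ^ J : ℕ) : ℤ)
  have hn : n ≠ 0 := by
    change ((2 ^ J : ℕ) : ℤ) ≠ 0
    exact_mod_cast pow_ne_zero J two_ne_zero
  let B := W.geomTorsion n
  let ρ₀ : ContinuousRep (absoluteGaloisGroup (v.adicCompletion ℚ)) ℤ B := GaloisRep.restrictField (v.adicCompletion ℚ) (W.torsionGaloisModule n)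
  -- the restriction of `E[2^J]|` to `U_J`, as a continuous representation of the group `U_J`
  let τU : ContinuousRep U ℤ B := ρ₀.restrict (subgroupSubtypeHom U)
  have hρU : ∀ (x : U) (m : B), τU.toTopRep.ρ x m = ρ₀ (x : absoluteGaloisGroup (v.adicCompletion ℚ)) m := fun _ _ ↦ rfl
  let N' : Subgroup U := N.subgroupOf U
  let ι : B → localPoints W (v.adicCompletion ℚ) := fun t ↦ pointsMap W (v.adicCompletion ℚ) (t : W.geomPoints)
  let θ : B ≃+ AddSubgroup.torsionBy (localPoints W (v.adicCompletion ℚ)) n := W.torsionPointsEquiv n (E := v.adicCompletion ℚ) hn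
  have galois_smul_nsmul : ∀ (τ : absoluteGaloisGroup (v.adicCompletion ℚ)) (k : ℕ) (P : localPoints W (v.adicCompletion ℚ)), τ • (k • P) = k • (τ • P) :=
    fun τ k P ↦ map_nsmul (DistribSMul.toAddMonoidHom (localPoints W (v.adicCompletion ℚ)) τ) k P
  have hιinj : Function.Injective ι := fun a c hac ↦ θ.injective (Subtype.ext hac)
  have hιadd : ∀ a c : B, ι (a + c) = ι a + ι c := fun a c ↦ by
    change pointsMap W _ ((a : W.geomPoints) + c) = _; rw [map_add]
  have hιsub : ∀ a c : B, ι (a - c) = ι a - ι c := fun a c ↦ by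
    change pointsMap W _ ((a : W.geomPoints) - c) = _; rw [map_sub]
  have hιnsmul : ∀ (c : ℕ) (a : B), ι (c • a) = c • ι a := fun c a ↦ by
    change pointsMap W _ (((c • a : B) : W.geomPoints)) = _
    rw [AddSubgroupClass.coe_nsmul, map_nsmul]
  have hιgal : ∀ (σ : absoluteGaloisGroup (v.adicCompletion ℚ)) (a : B), ι (resGal (K := ℚ) (v.adicCompletion ℚ) σ • a) = σ • ι a := fun σ a ↦ by
    change pointsMap W _ (((resGal (K := ℚ) (v.adicCompletion ℚ) σ • a : B) : W.geomPoints)) = _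
    rw [Literature.NumberTheory.EllipticCurves.AddSubgroup.torsionBy.coe_smul, pointsMap_smul]
  have hιθsymm : ∀ T : AddSubgroup.torsionBy (localPoints W (v.adicCompletion ℚ)) n, ι (θ.symm T) = T := fun T ↦ W.pointsMap_torsionPointsEquiv_symm n hn T
  have hρ : ∀ (σ : absoluteGaloisGroup (v.adicCompletion ℚ)) (m : B), ρ₀ σ m = resGal (K := ℚ) (v.adicCompletion ℚ) σ • m := fun σ m ↦ by
    change W.torsionGaloisModule n (resGal (K := ℚ) (v.adicCompletion ℚ) σ) m = _
    rw [torsionGaloisModule_apply_apply]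
  have hρN' : ∀ (x : N') (m : B), (subgroupRep τU.toTopRep N').ρ x m = ρ₀ ((x : U) : absoluteGaloisGroup (v.adicCompletion ℚ)) m :=
    fun x m ↦ by rw [subgroupRep_ρ_apply, hρU]
  have hρN : ∀ (x : N) (m : B),
      (subgroupRep (DiscreteGaloisModule.toTopRep (GaloisRep.restrictField (v.adicCompletion ℚ) (W.torsionGaloisModule n))) N).ρ x m =
        ρ₀ (x : absoluteGaloisGroup (v.adicCompletion ℚ)) m := fun _ _ ↦ rfl
  have hρX₀U : ∀ (x : U) (m : B), (subgroupRep (LayerPairing.torsionLocalRep W (2 ^ J) v) U).ρ x m = ρ₀ (x : absoluteGaloisGroup (v.adicCompletion ℚ)) m :=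
    fun _ _ ↦ rfl
  have hAtower : A ≤ localTowerPointsOfEmb κ (closureEmb (K := ℚ) (v.adicCompletion ℚ)) W :=
    PlusDualTwo.iSup_signedLocalPoints_le_localTowerPointsOfEmb W κ v
  have h2J : ∀ P : localPoints W (v.adicCompletion ℚ), n • P = 2 ^ J • P := fun P ↦ natCast_zsmul P (2 ^ J)
  -- the root `Q` of `b` and its Kummer cocycle on `N`
  let Q : localPoints W (v.adicCompletion ℚ) := W.subgroupZSMulRoot n hn b
  have hQb : 2 ^ J • Q = b := by rw [← h2J]; exact W.zsmul_subgroupZSMulRoot n hn b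
  have hQN : n • Q ∈ FixedPoints.addSubgroup N (localPoints W (v.adicCompletion ℚ)) := by
    rw [h2J, hQb]; exact hAtower hb
  let κ₀ := W.subgroupKummerCocycle n N hn Q hQN
  have hκ₀ : ∀ τ : N, ι (κ₀.1 τ) = (τ : absoluteGaloisGroup (v.adicCompletion ℚ)) • Q - Q := fun τ ↦ W.pointsMap_subgroupKummerCocycle_apply n N hn Q hQN τ
  -- the same cocycle on `N' = N ∩ U_J ≤ U_J`, for `τU`
  obtain ⟨cQ, hcQv⟩ : ∃ cQ : contOneCocycles (subgroupRep τU.toTopRep N'),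
      ∀ a : N', cQ.1 a = κ₀.1 ⟨((a : U) : absoluteGaloisGroup (v.adicCompletion ℚ)), a.2⟩ :=
    ⟨⟨⟨fun a ↦ κ₀.1 ⟨((a : U) : absoluteGaloisGroup (v.adicCompletion ℚ)), a.2⟩,
      κ₀.1.continuous.comp ((continuous_subtype_val.comp continuous_subtype_val).subtype_mk _)⟩, fun a c ↦ by
      rw [hρN']
      have h := κ₀.2 ⟨((a : U) : absoluteGaloisGroup (v.adicCompletion ℚ)), a.2⟩ ⟨((c : U) : absoluteGaloisGroup (v.adicCompletion ℚ)), c.2⟩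
      rw [hρN] at h
      exact h⟩, fun _ ↦ rfl⟩
  have hcQ : ∀ a : N', ι (cQ.1 a) = ((a : U) : absoluteGaloisGroup (v.adicCompletion ℚ)) • Q - Q := fun a ↦ by
    rw [hcQv]; exact hκ₀ ⟨((a : U) : absoluteGaloisGroup (v.adicCompletion ℚ)), a.2⟩
  -- the torsion element controlling the `g^{2^J}`-invariance
  obtain ⟨w, hw, hwe⟩ := hfix
  have hwN : ∀ τ : absoluteGaloisGroup (v.adicCompletion ℚ), τ ∈ N → τ • w = w := (mem_localTowerPointsOfEmb_iff κ _ W w).1 (hAtower hw)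
  have hT : g ^ (2 ^ m) • Q - Q - w ∈ AddSubgroup.torsionBy (localPoints W (v.adicCompletion ℚ)) n := by
    refine (Submodule.mem_torsionBy_iff _ _).mpr ?_
    change n • (g ^ (2 ^ m) • Q - Q - w) = 0
    rw [h2J, smul_sub, smul_sub, ← galois_smul_nsmul, hQb, hwe, sub_self]
  let bT : B := θ.symm ⟨_, hT⟩
  have hιbT : ι bT = g ^ (2 ^ m) • Q - Q - w := hιθsymm ⟨_, hT⟩
  -- `g^{2^J} ∈ U_J`
  have hg1 : κ (resGal (K := ℚ) (v.adicCompletion ℚ) g) = Multiplicative.ofAdd 1 := by rw [resGal_eq]; exact hg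
  have hgU : g ^ (2 ^ m) ∈ U := by
    refine (mem_localSubgroupOfEmb_iff _ _ _).mpr ?_
    rw [← resGal_eq, ZpExtension.mem_layerSubgroup, map_pow, map_pow, hg1, ← ofAdd_nsmul, toAdd_ofAdd, nsmul_eq_mul, mul_one]
    exact ⟨1, by push_cast; ring⟩
  let γ' : U := ⟨g ^ (2 ^ m), hgU⟩
  -- the class of `cQ` is fixed by the conjugation by `g^{2^J}`
  have hinv : conjMap τU.toTopRep N' γ' 1 (oneCocycleClass _ cQ) = oneCocycleClass _ cQ := by
    rw [conjMap_oneCocycleClass, ← sub_eq_zero, ← oneCocycleClass_sub, oneCocycleClass_eq_zero_iff]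
    refine ⟨bT, fun a ↦ ?_⟩
    rw [Submodule.coe_sub, ContinuousMap.sub_apply, conj_pullback_apply, hρU, hρN']
    change ρ₀ (g ^ (2 ^ m)) (cQ.1 (subgroupConj N' γ' a)) - cQ.1 a = ρ₀ ((a : U) : absoluteGaloisGroup (v.adicCompletion ℚ)) bT - bT
    apply hιinj
    rw [hιsub, hρ, hιgal, hcQ, hcQ, hιsub, hρ, hιgal, hιbT]
    have hconj : (((subgroupConj N' γ' a : N') : U) : absoluteGaloisGroup (v.adicCompletion ℚ)) =
        (g ^ (2 ^ m))⁻¹ * ((a : U) : absoluteGaloisGroup (v.adicCompletion ℚ)) * g ^ (2 ^ m) := by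
      rw [subgroupConj_apply_coe, Subgroup.coe_mul, Subgroup.coe_mul, Subgroup.coe_inv]
    rw [hconj]
    have e5 : g ^ (2 ^ m) • (((g ^ (2 ^ m))⁻¹ * ((a : U) : absoluteGaloisGroup (v.adicCompletion ℚ)) * g ^ (2 ^ m)) • Q) = ((a : U) : absoluteGaloisGroup (v.adicCompletion ℚ)) • g ^ (2 ^ m) • Q := by
      rw [← mul_smul, ← mul_assoc, ← mul_assoc, mul_inv_cancel, one_mul, mul_smul]
    rw [smul_sub (g ^ (2 ^ m)), e5, smul_sub ((a : U) : absoluteGaloisGroup (v.adicCompletion ℚ)),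
      smul_sub ((a : U) : absoluteGaloisGroup (v.adicCompletion ℚ)), hwN _ (Subgroup.mem_subgroupOf.mp a.2)]
    abel
  -- the layer character and the `ℤ₂`-quotient `U_J/N`
  obtain ⟨κJ, hκJ⟩ := TwistedLocalKummer.exists_layerCharacter κ v m
  have hpa : ((2 : ℤ_[2]) ^ m) ≠ 0 := pow_ne_zero _ (Nat.cast_ne_zero.mpr two_ne_zero)
  have hL : ∀ a : U, a ∈ N' ↔ κJ a = 1 := by
    intro a
    rw [Subgroup.mem_subgroupOf]
    change κ (resGal (K := ℚ) (v.adicCompletion ℚ) ((a : U) : absoluteGaloisGroup (v.adicCompletion ℚ))) = 1 ↔ _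
    constructor
    · intro h
      have h1 := hκJ a
      rw [h, toAdd_one, mul_eq_zero] at h1
      rcases h1 with h1 | h1
      · exact absurd h1 hpa
      · rw [← ofAdd_toAdd (κJ a), h1]; rfl
    · intro h
      have h1 := hκJ a
      rw [h, toAdd_one, mul_zero] at h1
      rw [← ofAdd_toAdd (κ _), ← h1]; rfl
  have hγ1 : κJ γ' = Multiplicative.ofAdd 1 := by
    have h1 := hκJ γ'
    change (2 : ℤ_[2]) ^ m * (κJ γ').toAdd = (κ (resGal (K := ℚ) (v.adicCompletion ℚ) (g ^ (2 ^ m)))).toAdd at h1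
    rw [map_pow, map_pow, hg1, ← ofAdd_nsmul, toAdd_ofAdd, nsmul_eq_mul, mul_one] at h1
    have h2 : (κJ γ').toAdd = 1 := mul_left_cancel₀ hpa (by rw [h1]; push_cast; ring)
    rw [← ofAdd_toAdd (κJ γ'), h2]
  have hBprim : ∀ t : B, ∃ e : ℕ, 2 ^ e • t = 0 := fun t ↦ ⟨J, W.pow_nsmul_geomTorsion_pow 2 J t⟩
  obtain ⟨xc, hxc⟩ := exists_resSubgroup_eq_of_conjMap_eq_of_padicInt τU hBprim κJ N' hL hγ1 (oneCocycleClass _ cQ) hinv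
  -- (destructuring existentials typed by `τU.toTopRep` with `rcases` is slow here; use `Classical.choose`)
  have hsurj := oneCocycleClass_surjective τU.toTopRep xc
  let ξ : contOneCocycles τU.toTopRep := Classical.choose hsurj
  have hξ : oneCocycleClass _ ξ = xc := Classical.choose_spec hsurj
  rw [← hξ] at hxc
  have hcob := TwistedLocalKummer.exists_apply_eq_add_coboundary_of_resSubgroup_eq τU.toTopRep N' ξ cQ hxc
  let bb : B := Classical.choose hcob
  have hbb : ∀ a : N', ξ.1 (a : U) = cQ.1 a + ((subgroupRep τU.toTopRep N').ρ a bb - bb) := Classical.choose_spec hcob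
  -- the `U_J`-cocycle of the untwisted local module with the same values as `ξ`
  let ψ : contOneCocycles (subgroupRep (LayerPairing.torsionLocalRep W (2 ^ J) v) (LayerPairing.layerGroup κ v m)) :=
    contOneCocycles.pullback (ContinuousMonoidHom.id _) (X := τU.toTopRep)
      (Y := subgroupRep (LayerPairing.torsionLocalRep W (2 ^ J) v) (LayerPairing.layerGroup κ v m))
      (TopRep.ofHom ⟨ContinuousLinearMap.id ℤ B, fun _ => rfl⟩) ξ
  have hψ : ∀ σ, ψ.1 σ = ξ.1 σ := fun _ ↦ rfl
  have hιJ : ∀ t : B, 2 ^ J • ι t = 0 := fun t ↦ by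
    rw [← hιnsmul, W.pow_nsmul_geomTorsion_pow 2 J t]
    change pointsMap W _ ((0 : B) : W.geomPoints) = 0
    rw [ZeroMemClass.coe_zero, map_zero]
  refine ⟨ψ, Q + ι bb, by rw [smul_add, hQb, hιJ bb, add_zero], fun τ hτ ↦ ?_⟩
  have hτ' : (⟨τ, hNU hτ⟩ : U) ∈ N' := (Subgroup.mem_subgroupOf).mpr hτ
  have h := hbb ⟨⟨τ, hNU hτ⟩, hτ'⟩
  rw [hρN'] at h
  change ξ.1 ⟨τ, hNU hτ⟩ = cQ.1 ⟨⟨τ, hNU hτ⟩, hτ'⟩ + (ρ₀ τ bb - bb) at h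
  change ι (ψ.1 ⟨τ, hNU hτ⟩) = _
  rw [hψ, h, hιadd, hιsub, hρ, hιgal, hcQ, smul_add]
  change τ • Q - Q + (τ • ι bb - ι bb) = τ • Q + τ • ι bb - (Q + ι bb)
  abel


end Summit.BirchSwinnertonDyer.BirchSwinnertonDyer.Theorems.SignedEC.LayerWitnessDict

end
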